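import Summits.QuantumFields.YangMills.Theorems.UnitScaleTiltProp7QprimeCombBumpSectionRows
import Summits.QuantumFields.YangMills.Theorems.UnitScaleTiltProp7CombCompetitorPullback
import Summits.QuantumFields.YangMills.Theorems.UnitScaleTiltProp7DbarTwWindow
import Literature.MathematicalPhysics.QuantumFieldTheory.Balaban1983to89.T3PrintedMinimiserExistence
import HarnessLib

/-!
# Route `UnitScaleTilt`, crux K1 «MinimiserStabilityRegPr» (stmt-QuantumFields-19200) — route-R E′ (A′), LANE II «DIVERGENCE RECOVERY AT CURVED `W`» (★★OWNER RULING №23),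
# brick (B7-MEMBER-CORE), the two COARSE CONTRACTION ROWS `hGN` («GN») and `hQN` («QN») of ★p1 g19's `Prop7DivRecoveryAssemblyHilbert.member_core_row` (SIGNATURE eca0df6b, NAMER WORD №11 (4)):
# `c₀ℓ³·Σ_c ‖Ad(Ū(c)) w(c₊) − w(c₋)‖² ≤ 12·(c₀ℓ³·Σ_y ‖w y‖²)` (CG = 4d = 12) and `c₀ℓ³·Σ_y ‖(Q′_k(W)μ)(y)‖² ≤ ‖μ‖²` (CN = 1), `Q′ = QprimeCombL2 W`, `Ū = descendToGL (W♭) ∘ bondShift⁻¹`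

Cell `ym3-torus` (HUMAN RULING D-0037, YM ladder rung R3), D-0154 (3c) twin-width seat `ym-routeR-w3` (gen 8; route-R v2 second registered line).  THEOREMS ONLY (0 `def`, 0 `sorry`);
`--supports stmt-QuantumFields-19200 --as helper`, count-neutral.  YM₃ on T³ is a ladder rung (R3) — NOT d = 4, NOT infinite volume, NOT a mass gap, NOT the Clay problem; nothing here
claims (REC), `hN06`, E′, the stub `stub_existenceMinimalOrbit`, the crux or the gap.

WHY.  ★p1 g19's (B7-MEMBER-CORE) instantiates the abstract (REC) core ✓ `Prop7DivRecoveryAssemblyCore.norm_sq_le_rows_H1` at the member with the coarse currencies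
`Gc w := c₀ℓ³·Σ_c ‖Ad(Ū(c)) w(c₊) − w(c₋)‖²` and `Nc w := c₀ℓ³·Σ_y ‖w y‖²` (`ℓ = L^{K−n}`), displaying two elementary rows as hypotheses: `hGN : Gc w ≤ CG·Nc w` (the coarse covariant
gradient is bounded by the coarse mass — the transporters are unitary) and `hQN : Nc (Q′μ) ≤ CN·‖μ‖²` (print's comb site averaging (3.19) is a contraction from the fine weighted `L²`
space to the coarse one — Jensen on each `ℓ³`-block with unitary comb transporters, [Balaban1985BackgroundPropagators] (3.24) p. 394).  This file proves both at a printed-regular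
background with the ABSOLUTE constants `CG = 12`, `CN = 1`.

WHAT IS PROVED (ns `…Theorems.Prop7DivRecoveryCoarseRows`).
* §1 (GN) `sum_normSq_conjR_shift_sub_le` (any `Params`, any level, transporters in `U1`: `Σ_c‖Ad(T c) w(c₊) − w(c₋)‖² ≤ 4d·Σ_y‖w y‖²`), ★ `coarseGrad_le_twelve_coarseMass_of_regPr`
  (the member row `hGN` with `CG = 12`, transporter `descendToGL F n K h (bgUnits F K W) ((bondShift (sites_eq F n K h)).symm c)` ∈ SU(2) by ✓ `Prop7DbarTwWindow`).
* §2 (counting) `iterate_blockMap_eq_blockMap_pow`, `sum_box_mul_eq_sum_sum_blockSites` (`Σ_{z∈[0,LᵏN)ᵈ} g z = Σ_{Y∈[0,N)ᵈ} Σ_{x∈Bᵏ(Y)} g x`), `normSq_QprimeIter_le_blockSum`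
  (`‖Q′_k h(z)‖² ≤ (L⁻ᵈ)ᵏ·Σ_{x∈Bᵏ(z)}‖h x‖²`, transporters in `U1`; ✓ `Prop7CombCompetitorPullback.norm_QprimeIter_le_of_le` + Cauchy–Schwarz), `norm_sq_toL2S_eq`
  (`‖toL2S l‖² = c₀·Σ_x‖frobEquiv⁻¹(l x)‖²`).
* §3 (QN) ★★ `coarseMass_QprimeCombL2_le_normSq_of_regPr` — the member row `hQN` with `CN = 1`: `c₀ℓ³·Σ_y‖QprimeCombL2 F n K c₀ W μ y‖² ≤ 1·‖μ‖²` on `RegPr F n K e W`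
  under [B7] Prop. 2's windows (`C0·2e ≤ 1∕3`, `4e ≤ c₂′`).
* §4 ★★ `coarse_rows` — both rows packaged in the shape `∀ L, 1 < L → ∃ eN > 0, ∀ F (F.L = L) n K (hnK) e, 0 < e → e ≤ eN → ∀ W, RegPr F n K e W → (GN) ∧ (QN)` (windows discharged
  inside, as ✓ `Prop7TwistedIntertwining.intertwining_rows`).
HONEST SCOPE.  Lattice bookkeeping over landed letters (unitary transporters, block tiling of the period cell, operator ≤ Frobenius norm); no estimate of print beyond (3.24)'s Jensen step;
nothing of (REC)∕`hN06`∕E′∕EX∕the crux is proved.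

References: T. Bałaban, CMP 99 (1985) 389–434 [Balaban1985BackgroundPropagators] ((3.3) p.391, (3.11) p.392, (3.17)–(3.19) p.393, (3.24) p.394); CMP 98 (1985) 17–51 [Balaban1985Averaging]
(Prop. 2 p.26, (78) p.30); CMP 99 (1985) 75–102 [Balaban1985RegularSpaces] (p.77).
-/

set_option autoImplicit false

noncomputable section

open scoped InnerProductSpace Matrix.Norms.L2Operator BigOperators

namespace Summit.QuantumFields.YangMills.Theorems.Prop7DivRecoveryCoarseRows

open Literature.MathematicalPhysics.QuantumFieldTheory.Balaban1983to89
open Literature.MathematicalPhysics.QuantumFieldTheory.Balaban1983to89.T3ContinuumYM3Torus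
open Literature.MathematicalPhysics.QuantumLattice (blockMap blockSites mem_blockSites_iff card_blockSites)
open B7Prop1Explicit renaming Site → LSite
open B7Prop1Explicit (U1)
open B7Prop2Explicit (C0 c2' unitaryUnits unitaryUnits_le_U1 C0_pos c2'_pos)
open B7Prop2SpecialUnitary (specialUnitaryUnits specialUnitaryUnits_le_U1)
open B7Eq78Linearization (conjR QprimeIter zdBlocking)
open B7BlockGeometry (blockMap_blockMap)
open B8Ineq132 (norm_conjR)
open B8Eq119TwistedAxial (bgT)
open B10Eq27TorusAxialLog (transl pull)
open B10StarCount (sum_pbond shiftEquiv)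
open T4TermwiseTorus (tcls tlift tcls_tlift box mem_box tlift_mem_box tlift_tcls_of_mem_box)
open T3PrintedRegularMinimiser (RegPr)
open T3LevelShift (bondShift)
open T3PrintedRegularOrbits (sites_eq)
open T3SectALandauChart (bgUnits)
open B11Eq103H1Complex (SiteL2K)
open Summit.QuantumFields.YangMills.Theorems.Prop7SectET3Transport (periodsT3)
open Summit.QuantumFields.YangMills.Theorems.Prop7SectET3HilbertLetters (W₂ frobEquiv toL2S toL2S_symm_apply inner_frobEquiv_symm)
open Summit.QuantumFields.YangMills.Theorems.Prop7SPrint (basePt)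
open Summit.QuantumFields.YangMills.Theorems.Prop7SymAvgGL (descendToGL)
open Summit.QuantumFields.YangMills.Theorems.Prop7QprimeCombL2 (QprimeCombL2 QprimeCombL2_apply sitesPerDir_zero_eq)
open Summit.QuantumFields.YangMills.Theorems.Prop7LandauCombDict (sum_univ_eq_sum_box_transl bgT_pull_mem_unitaryUnits_of_regPr)
open Summit.QuantumFields.YangMills.Theorems.Prop7QprimeCombBumpSectionRows (iterate_blockMap_mem_box_iff transl_zero_eq_tcls)
open Summit.QuantumFields.YangMills.Theorems.Prop7RieszTauFrobNorm (norm_le_norm_frobEquiv_symm)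
open Summit.QuantumFields.YangMills.Theorems.Prop7CombCompetitorPullback (norm_QprimeIter_le_of_le)
open Summit.QuantumFields.YangMills.Theorems.Prop7DbarTwWindow (descendToGL_bgUnits_mem_specialUnitaryUnits_of_regPr)

/-! ## §1 (GN) The coarse covariant gradient is bounded by `4d` times the coarse mass -/

section GN

variable {P : Params} {j : ℕ}

/-- **COVARIANT DIFFERENCE ≤ TWICE THE MASSES** (any torus, any level, transporters in `U1`): `Σ_c ‖Ad(T c) w(c₊) − w(c₋)‖² ≤ 4d·Σ_y ‖w y‖²` —
`‖Ad(T)a − b‖² ≤ 2‖a‖² + 2‖b‖²` (`‖Ad(T)a‖ = ‖a‖`), then every site is the source of `d` bonds and the target of `d` bonds. [cite: Balaban1985BackgroundPropagators, (3.3) p.391] -/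
theorem sum_normSq_conjR_shift_sub_le (T : PBond P j → (Matrix (Fin 2) (Fin 2) ℂ)ˣ) (hT : ∀ c, T c ∈ U1 (Matrix (Fin 2) (Fin 2) ℂ))
    (w : Site P j → Matrix (Fin 2) (Fin 2) ℂ) :
    ∑ c : PBond P j, ‖conjR (T c) (w (c.src.shift c.dir)) - w c.src‖ ^ 2 ≤ 4 * P.d * ∑ y : Site P j, ‖w y‖ ^ 2 := by
  have hpt : ∀ c : PBond P j, ‖conjR (T c) (w (c.src.shift c.dir)) - w c.src‖ ^ 2 ≤ 2 * ‖w (c.src.shift c.dir)‖ ^ 2 + 2 * ‖w c.src‖ ^ 2 := by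
    intro c
    have h1 : ‖conjR (T c) (w (c.src.shift c.dir)) - w c.src‖ ≤ ‖w (c.src.shift c.dir)‖ + ‖w c.src‖ := by
      calc _ ≤ ‖conjR (T c) (w (c.src.shift c.dir))‖ + ‖w c.src‖ := norm_sub_le _ _
        _ = ‖w (c.src.shift c.dir)‖ + ‖w c.src‖ := by rw [norm_conjR (hT c)]
    have h0 : 0 ≤ ‖conjR (T c) (w (c.src.shift c.dir)) - w c.src‖ := norm_nonneg _
    have h2 : ‖conjR (T c) (w (c.src.shift c.dir)) - w c.src‖ ^ 2 ≤ (‖w (c.src.shift c.dir)‖ + ‖w c.src‖) ^ 2 := pow_le_pow_left₀ h0 h1 2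
    nlinarith [h2, sq_nonneg (‖w (c.src.shift c.dir)‖ - ‖w c.src‖)]
  have hsrc : ∑ c : PBond P j, ‖w c.src‖ ^ 2 = P.d * ∑ y : Site P j, ‖w y‖ ^ 2 := by
    rw [sum_pbond]
    simp only [Finset.sum_const, Finset.card_univ, Fintype.card_fin, nsmul_eq_mul]
    rw [Finset.mul_sum]
  have htgt : ∑ c : PBond P j, ‖w (c.src.shift c.dir)‖ ^ 2 = P.d * ∑ y : Site P j, ‖w y‖ ^ 2 := by
    rw [sum_pbond, Finset.sum_comm]
    have hμ : ∀ μ : Fin P.d, ∑ x : Site P j, ‖w (x.shift μ)‖ ^ 2 = ∑ y : Site P j, ‖w y‖ ^ 2 := fun μ =>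
      Fintype.sum_equiv (shiftEquiv μ) (fun x => ‖w (x.shift μ)‖ ^ 2) (fun y => ‖w y‖ ^ 2) fun _ => rfl
    simp only [hμ, Finset.sum_const, Finset.card_univ, Fintype.card_fin, nsmul_eq_mul]
  calc ∑ c : PBond P j, ‖conjR (T c) (w (c.src.shift c.dir)) - w c.src‖ ^ 2
      ≤ ∑ c : PBond P j, (2 * ‖w (c.src.shift c.dir)‖ ^ 2 + 2 * ‖w c.src‖ ^ 2) := Finset.sum_le_sum fun c _ => hpt c
    _ = 2 * ∑ c : PBond P j, ‖w (c.src.shift c.dir)‖ ^ 2 + 2 * ∑ c : PBond P j, ‖w c.src‖ ^ 2 := by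
        rw [Finset.sum_add_distrib, Finset.mul_sum, Finset.mul_sum]
    _ = 4 * P.d * ∑ y : Site P j, ‖w y‖ ^ 2 := by rw [hsrc, htgt]; ring

end GN

section Member

variable (F : T3Family) {n K : ℕ}

/-- ★ **(GN) THE ROW `hGN` OF (B7-MEMBER-CORE) WITH `CG = 12`**: on `RegPr F n K e W` (`0 < e`, `10⁷L³e ≤ 1`) the coarse transporter `Ū(c) := descendToGL (W♭)((bondShift)⁻¹ c)` is
`SU(2)`-valued (✓ `descendToGL_bgUnits_mem_specialUnitaryUnits_of_regPr`), so for every coarse site field `w` and every weight `c ≥ 0`: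
`c·ℓ³·Σ_c ‖Ad(Ū(c)) w(c₊) − w(c₋)‖² ≤ 12·(c·ℓ³·Σ_y ‖w y‖²)` (`4d = 12` at `d = 3`). [cite: Balaban1985BackgroundPropagators, (3.3) p.391, (3.19) p.393; Balaban1987RG1, (0.4) p.253] -/
theorem coarseGrad_le_twelve_coarseMass_of_regPr (hnK : n ≤ K) {e : ℝ} (he : 0 < e) (he7 : 10 ^ 7 * (F.L : ℝ) ^ 3 * e ≤ 1)
    (W : GaugeField (F.P K) 0 (Matrix.specialUnitaryGroup (Fin 2) ℂ)) (hreg : RegPr F n K e W) {c : ℝ} (hc : 0 ≤ c)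
    (w : Site (F.P K) (K - n) → Matrix (Fin 2) (Fin 2) ℂ) :
    c * ((F.L : ℝ) ^ (K - n)) ^ 3 * ∑ b : PBond (F.P K) (K - n), ‖conjR (descendToGL F n K hnK (bgUnits F K W) ((bondShift (sites_eq F n K hnK)).symm b))
        (w (b.src.shift b.dir)) - w b.src‖ ^ 2
      ≤ 12 * (c * ((F.L : ℝ) ^ (K - n)) ^ 3 * ∑ y : Site (F.P K) (K - n), ‖w y‖ ^ 2) := by
  have hT : ∀ b : PBond (F.P K) (K - n), descendToGL F n K hnK (bgUnits F K W) ((bondShift (sites_eq F n K hnK)).symm b) ∈ U1 (Matrix (Fin 2) (Fin 2) ℂ) :=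
    fun b => specialUnitaryUnits_le_U1 (descendToGL_bgUnits_mem_specialUnitaryUnits_of_regPr F hnK he he7 W hreg _)
  have h := sum_normSq_conjR_shift_sub_le _ hT w
  have hd : ((F.P K).d : ℝ) = 3 := by rw [T3Family.P_d F K]; norm_num
  rw [hd] at h
  have hpos : 0 ≤ c * ((F.L : ℝ) ^ (K - n)) ^ 3 := by positivity
  have := mul_le_mul_of_nonneg_left h hpos
  linarith

end Member

/-! ## §2 Counting: the `Lᵏ`-blocks tile the period cell; Jensen for the comb average -/

section Counting

variable {d : ℕ}

/-- `⌊·⌋_L` iterated `k` times is `⌊·⌋_{Lᵏ}`. [folklore] -/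
theorem iterate_blockMap_eq_blockMap_pow (L : ℕ) : ∀ (k : ℕ) (x : LSite d), (blockMap L)^[k] x = blockMap (L ^ k) x
  | 0, x => by
    funext i
    simp [Literature.MathematicalPhysics.QuantumLattice.blockMap]
  | k + 1, x => by
    rw [Function.iterate_succ_apply, iterate_blockMap_eq_blockMap_pow L k, blockMap_blockMap, pow_succ']

/-- **THE BLOCKS TILE THE PERIOD CELL**: `Σ_{z ∈ [0,LᵏN)ᵈ} g z = Σ_{Y ∈ [0,N)ᵈ} Σ_{x ∈ Bᵏ(Y)} g x` (`Bᵏ(Y) = {x : ⌊x⌋_{Lᵏ} = Y}`). [cite: Balaban1985Averaging, (78) p.30; Balaban1985RegularSpaces, p.77] -/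
theorem sum_box_mul_eq_sum_sum_blockSites {M : Type*} [AddCommMonoid M] (L : ℕ) [NeZero L] (k N : ℕ) (g : LSite d → M) :
    ∑ z ∈ box (d := d) (L ^ k * N), g z = ∑ Y ∈ box (d := d) N, ∑ x ∈ blockSites (L ^ k) Y, g x := by
  classical
  haveI : NeZero (L ^ k) := ⟨pow_ne_zero _ (NeZero.ne L)⟩
  have hmaps : ∀ z ∈ box (d := d) (L ^ k * N), blockMap (L ^ k) z ∈ box (d := d) N := fun z hz => by
    rw [← iterate_blockMap_eq_blockMap_pow]; exact (iterate_blockMap_mem_box_iff L k N z).1 hz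
  rw [← Finset.sum_fiberwise_of_maps_to hmaps]
  refine Finset.sum_congr rfl fun Y hY => Finset.sum_congr ?_ fun _ _ => rfl
  ext x
  rw [Finset.mem_filter, mem_blockSites_iff]
  constructor
  · exact fun h => h.2
  · intro h
    refine ⟨(iterate_blockMap_mem_box_iff L k N x).2 ?_, h⟩
    rw [iterate_blockMap_eq_blockMap_pow, h]; exact hY

variable {𝔸 : Type*} [NormedRing 𝔸] [NormOneClass 𝔸] [NormedAlgebra ℂ 𝔸]

/-- **JENSEN FOR THE COMB AVERAGE**: with transporters in `U1` below level `k`, `‖(Q′_k h)(z)‖² ≤ (L⁻ᵈ)ᵏ·Σ_{x ∈ Bᵏ(z)} ‖h x‖²` (✓ `norm_QprimeIter_le_of_le`, then Cauchy–Schwarz over the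
`(Lᵈ)ᵏ` sites of the block). [cite: Balaban1985BackgroundPropagators, (3.18)-(3.19) p.393, (3.24) p.394] -/
theorem normSq_QprimeIter_le_blockSum {L : ℕ} (hL : 0 < L) (T : ℕ → LSite d → LSite d → 𝔸ˣ) (k : ℕ) (hT1 : ∀ j < k, ∀ z x', T j z x' ∈ U1 𝔸)
    (h : LSite d → 𝔸) (z : LSite d) :
    ‖QprimeIter (zdBlocking d L) T k h z‖ ^ 2 ≤ (((L : ℝ) ^ d)⁻¹) ^ k * ∑ x ∈ blockSites (L ^ k) z, ‖h x‖ ^ 2 := by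
  have h1 := norm_QprimeIter_le_of_le hL T k hT1 h k le_rfl z
  have hc : 0 < (((L : ℝ) ^ d)⁻¹) ^ k := by positivity
  have hcard : ((blockSites (L ^ k) z).card : ℝ) = ((L : ℝ) ^ d) ^ k := by
    rw [card_blockSites]; push_cast; ring
  have hCS := sq_sum_le_card_mul_sum_sq (s := blockSites (L ^ k) z) (f := fun x => ‖h x‖)
  rw [hcard] at hCS
  have hinv : (((L : ℝ) ^ d)⁻¹) ^ k * ((L : ℝ) ^ d) ^ k = 1 := by
    rw [← mul_pow, inv_mul_cancel₀ (by positivity), one_pow]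
  calc ‖QprimeIter (zdBlocking d L) T k h z‖ ^ 2 ≤ ((((L : ℝ) ^ d)⁻¹) ^ k * ∑ x ∈ blockSites (L ^ k) z, ‖h x‖) ^ 2 :=
        pow_le_pow_left₀ (norm_nonneg _) h1 2
    _ = (((L : ℝ) ^ d)⁻¹) ^ k * ((((L : ℝ) ^ d)⁻¹) ^ k * (∑ x ∈ blockSites (L ^ k) z, ‖h x‖) ^ 2) := by ring
    _ ≤ (((L : ℝ) ^ d)⁻¹) ^ k * ((((L : ℝ) ^ d)⁻¹) ^ k * (((L : ℝ) ^ d) ^ k * ∑ x ∈ blockSites (L ^ k) z, ‖h x‖ ^ 2)) :=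
        mul_le_mul_of_nonneg_left (mul_le_mul_of_nonneg_left hCS hc.le) hc.le
    _ = (((L : ℝ) ^ d)⁻¹) ^ k * ∑ x ∈ blockSites (L ^ k) z, ‖h x‖ ^ 2 := by
        have e : (((L : ℝ) ^ d)⁻¹) ^ k * (((L : ℝ) ^ d) ^ k * ∑ x ∈ blockSites (L ^ k) z, ‖h x‖ ^ 2) = ∑ x ∈ blockSites (L ^ k) z, ‖h x‖ ^ 2 := by
          rw [← mul_assoc, hinv, one_mul]
        rw [e]

end Counting

/-! ## §3 (QN) The comb site averaging is a contraction `L²_{c₀}(T⁽⁰⁾) → L²_{c₀ℓ³}(T⁽ᵏ⁾)` -/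

section QN

variable (F : T3Family) {n K : ℕ} {c₀ : ℝ} [Fact (0 < c₀)]

/-- `‖toL2S l‖² = c₀·Σ_x ‖frobEquiv⁻¹(l x)‖²` (the weighted Frobenius sum). [cite: Balaban1985BackgroundPropagators, (3.11) p.392] -/
theorem norm_sq_toL2S_eq (l : Site (F.P K) 0 → Matrix (Fin 2) (Fin 2) ℂ) :
    ‖toL2S F K c₀ l‖ ^ 2 = c₀ * ∑ x : Site (F.P K) 0, ‖(frobEquiv.symm (l x) : W₂)‖ ^ 2 := by
  have h := Summit.QuantumFields.YangMills.Theorems.Prop7SectET3RealCoordSums.inner_toL2S (F := F) (K := K) (c₀ := c₀) l l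
  rw [← inner_self_eq_norm_sq (𝕜 := ℂ), h]
  simp only [RCLike.re_to_complex, Complex.re_ofReal_mul]
  congr 1
  rw [Complex.re_sum]
  refine Finset.sum_congr rfl fun x _ => ?_
  rw [← inner_frobEquiv_symm, ← inner_self_eq_norm_sq (𝕜 := ℂ)]
  rfl

/-- ★★ **(QN) THE ROW `hQN` OF (B7-MEMBER-CORE) WITH `CN = 1`**: on `RegPr F n K e W` in [B7] Prop. 2's windows (`0 < e`, `C0·2e ≤ 1∕3`, `4e ≤ c₂′`) the comb transporters
`W̄ʲ(Γ)` are unitary (✓ `bgT_pull_mem_unitaryUnits_of_regPr`), so for every gauge parameter `μ`: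
`c₀·ℓ³·Σ_{y : T⁽ᵏ⁾} ‖(QprimeCombL2 F n K c₀ W μ)(y)‖² ≤ 1·‖μ‖²` — Jensen on each `ℓ³`-block (§2), the blocks of the coarse sites tile the period cell, operator norm ≤ Frobenius norm.
[cite: Balaban1985BackgroundPropagators, (3.17)-(3.19) p.393, (3.24) p.394; Balaban1985Averaging, Prop. 2 p.26; Balaban1985RegularSpaces, p.77] -/
theorem coarseMass_QprimeCombL2_le_normSq_of_regPr (hnK : n ≤ K) {e : ℝ} (he : 0 < e) (hα3 : C0 (F.P K).d * (2 * e) ≤ 1 / 3)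
    (hα4 : 4 * e ≤ c2' (F.P K).d (F.P K).L) (W : GaugeField (F.P K) 0 (Matrix.specialUnitaryGroup (Fin 2) ℂ)) (hreg : RegPr F n K e W)
    (μ : SiteL2K ℂ 3 (periodsT3 F K) c₀ W₂) :
    c₀ * ((F.L : ℝ) ^ (K - n)) ^ 3 * ∑ y : Site (F.P K) (K - n), ‖QprimeCombL2 F n K c₀ W μ y‖ ^ 2 ≤ 1 * ‖μ‖ ^ 2 := by
  classical
  have hc₀ : 0 < c₀ := Fact.out
  haveI : NeZero (F.P K).L := ⟨by have h := F.hL.2; show F.L ≠ 0; omega⟩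
  have hLpos : 0 < (F.P K).L := Nat.pos_of_ne_zero (NeZero.ne _)
  have hd : (F.P K).d = 3 := T3Family.P_d F K
  have hPL : ((F.P K).L : ℝ) = F.L := rfl
  -- the fine field read on `ℤ³` at the base point
  set l : Site (F.P K) 0 → Matrix (Fin 2) (Fin 2) ℂ := (toL2S F K c₀).symm μ with hl
  have hμ : μ = toL2S F K c₀ l := by rw [hl, LinearEquiv.apply_symm_apply]
  set h : LSite (F.P K).d → Matrix (Fin 2) (Fin 2) ℂ := fun z => l (transl (basePt F n K) z) with hh
  -- unitary comb transporters
  have hT1 : ∀ j < K - n, ∀ z x' : LSite (F.P K).d,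
      bgT (F.P K).L (pull (bgUnits F K W) (basePt F n K)) j z x' ∈ U1 (Matrix (Fin 2) (Fin 2) ℂ) :=
    fun j hj z x' => by
      letI : CStarAlgebra (Matrix (Fin 2) (Fin 2) ℂ) := B10Eq29TubeLine.cstarAlgebraMatrix 2
      exact unitaryUnits_le_U1 (bgT_pull_mem_unitaryUnits_of_regPr F (n := n) he hα3 hα4 hreg j hj.le z x')
  -- Jensen per coarse site
  have hpt : ∀ y : Site (F.P K) (K - n), ‖QprimeCombL2 F n K c₀ W μ y‖ ^ 2
      ≤ ((((F.P K).L : ℝ) ^ (F.P K).d)⁻¹) ^ (K - n) * ∑ x ∈ blockSites ((F.P K).L ^ (K - n)) (tlift y), ‖h x‖ ^ 2 := by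
    intro y
    rw [QprimeCombL2_apply]
    exact normSq_QprimeIter_le_blockSum (by exact_mod_cast hLpos) _ (K - n) hT1 h (tlift y)
  -- the blocks of the coarse sites tile the period cell of the fine torus
  have htile : ∑ y : Site (F.P K) (K - n), ∑ x ∈ blockSites ((F.P K).L ^ (K - n)) (tlift y), ‖h x‖ ^ 2 = ∑ x : Site (F.P K) 0, ‖l x‖ ^ 2 := by
    rw [sum_univ_eq_sum_box_transl (0 : Site (F.P K) (K - n))]
    have h1 : ∀ z ∈ box (d := (F.P K).d) ((F.P K).sitesPerDir (K - n)),
        ∑ x ∈ blockSites ((F.P K).L ^ (K - n)) (tlift (transl (0 : Site (F.P K) (K - n)) z)), ‖h x‖ ^ 2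
          = ∑ x ∈ blockSites ((F.P K).L ^ (K - n)) z, ‖h x‖ ^ 2 := fun z hz => by
      rw [transl_zero_eq_tcls, tlift_tcls_of_mem_box hz]
    rw [Finset.sum_congr rfl h1, ← sum_box_mul_eq_sum_sum_blockSites, ← sitesPerDir_zero_eq F n K hnK, sum_univ_eq_sum_box_transl (basePt F n K)]
  -- operator norm ≤ Frobenius norm, and the weighted Frobenius sum is `‖μ‖²`
  have hfrob : c₀ * ∑ x : Site (F.P K) 0, ‖l x‖ ^ 2 ≤ ‖μ‖ ^ 2 := by
    rw [hμ, norm_sq_toL2S_eq]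
    exact mul_le_mul_of_nonneg_left (Finset.sum_le_sum fun x _ => pow_le_pow_left₀ (norm_nonneg _) (norm_le_norm_frobEquiv_symm _) 2) hc₀.le
  -- the volume factors cancel: `ℓ³·(L⁻³)ᵏ = 1`
  have hvol : ((F.L : ℝ) ^ (K - n)) ^ 3 * ((((F.P K).L : ℝ) ^ (F.P K).d)⁻¹) ^ (K - n) = 1 := by
    rw [hd, hPL, inv_pow, ← pow_mul, ← pow_mul, mul_comm (K - n) 3, mul_inv_cancel₀]
    have hL0 : (0 : ℝ) < F.L := by exact_mod_cast (show 0 < F.L from hLpos)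
    positivity
  calc c₀ * ((F.L : ℝ) ^ (K - n)) ^ 3 * ∑ y : Site (F.P K) (K - n), ‖QprimeCombL2 F n K c₀ W μ y‖ ^ 2
      ≤ c₀ * ((F.L : ℝ) ^ (K - n)) ^ 3 * ∑ y : Site (F.P K) (K - n),
          ((((F.P K).L : ℝ) ^ (F.P K).d)⁻¹) ^ (K - n) * ∑ x ∈ blockSites ((F.P K).L ^ (K - n)) (tlift y), ‖h x‖ ^ 2 :=
        mul_le_mul_of_nonneg_left (Finset.sum_le_sum fun y _ => hpt y) (by positivity)
    _ = c₀ * (((F.L : ℝ) ^ (K - n)) ^ 3 * ((((F.P K).L : ℝ) ^ (F.P K).d)⁻¹) ^ (K - n)) * ∑ x : Site (F.P K) 0, ‖l x‖ ^ 2 := by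
        rw [← Finset.mul_sum, htile]; ring
    _ = c₀ * ∑ x : Site (F.P K) 0, ‖l x‖ ^ 2 := by rw [hvol, mul_one]
    _ ≤ 1 * ‖μ‖ ^ 2 := by rw [one_mul]; exact hfrob

end QN

/-! ## §4 ★★ Both rows packaged with the windows discharged -/

/-- ★★ **THE COARSE CONTRACTION ROWS OF (B7-MEMBER-CORE), PACKAGED**: for every `L > 1` there is `eN > 0` (`= min(10⁻⁷L⁻³, (6C0)⁻¹, c₂′∕8)`) such that for every member of the family at
`L`, every `n < K`, every `0 < e ≤ eN` and every `W` with `RegPr F n K e W`: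
(GN) `∀ w, c₀ℓ³·Σ_c ‖Ad(Ū(c)) w(c₊) − w(c₋)‖² ≤ 12·(c₀ℓ³·Σ_y‖w y‖²)` and (QN) `∀ μ, c₀ℓ³·Σ_y ‖(QprimeCombL2 W μ)(y)‖² ≤ 1·‖μ‖²` — ★p1 g19's `hGN`∕`hQN` with `CG = 12`, `CN = 1`.
[cite: Balaban1985BackgroundPropagators, (3.3) p.391, (3.19) p.393, (3.24) p.394; Balaban1985Averaging, Prop. 2 p.26] -/
theorem coarse_rows (c₀ : ℕ → ℝ) [hc₀ : ∀ L : ℕ, Fact (0 < c₀ L)] : ∀ (L : ℕ), 1 < L → ∃ eN : ℝ, 0 < eN ∧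
    ∀ (F : T3Family), F.L = L → ∀ (n K : ℕ) (hnK : n < K) (e : ℝ), 0 < e → e ≤ eN →
      ∀ (W : GaugeField (F.P K) 0 (Matrix.specialUnitaryGroup (Fin 2) ℂ)), RegPr F n K e W →
        (∀ w : Site (F.P K) (K - n) → Matrix (Fin 2) (Fin 2) ℂ,
          c₀ F.L * ((F.L : ℝ) ^ (K - n)) ^ 3 * ∑ c : PBond (F.P K) (K - n), ‖conjR (descendToGL F n K hnK.le (bgUnits F K W) ((bondShift (sites_eq F n K hnK.le)).symm c))
              (w (c.src.shift c.dir)) - w c.src‖ ^ 2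
            ≤ 12 * (c₀ F.L * ((F.L : ℝ) ^ (K - n)) ^ 3 * ∑ y : Site (F.P K) (K - n), ‖w y‖ ^ 2)) ∧
        (∀ μ : SiteL2K ℂ 3 (periodsT3 F K) (c₀ F.L) W₂,
          c₀ F.L * ((F.L : ℝ) ^ (K - n)) ^ 3 * ∑ y : Site (F.P K) (K - n), ‖QprimeCombL2 F n K (c₀ F.L) W μ y‖ ^ 2 ≤ 1 * ‖μ‖ ^ 2) := by
  intro L hL
  have hC0 := C0_pos 3
  have hc2 := c2'_pos 3 L (by omega)
  have hL3 : (0 : ℝ) < (10 : ℝ) ^ 7 * (L : ℝ) ^ 3 := by positivity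
  obtain ⟨eN, heN⟩ : ∃ eN : ℝ, eN = min (1 / (10 ^ 7 * (L : ℝ) ^ 3)) (min (1 / (6 * C0 3)) (c2' 3 L / 8)) := ⟨_, rfl⟩
  have heNpos : 0 < eN := by rw [heN]; exact lt_min (by positivity) (lt_min (by positivity) (by positivity))
  have hw1 : 10 ^ 7 * (L : ℝ) ^ 3 * eN ≤ 1 := by
    have h1 : eN ≤ 1 / (10 ^ 7 * (L : ℝ) ^ 3) := by rw [heN]; exact min_le_left _ _
    rwa [le_div_iff₀ hL3, mul_comm] at h1
  have hw3 : C0 3 * (2 * eN) ≤ 1 / 3 := by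
    have h1 : eN ≤ 1 / (6 * C0 3) := by rw [heN]; exact (min_le_right _ _).trans (min_le_left _ _)
    have h2 : C0 3 * eN ≤ C0 3 * (1 / (6 * C0 3)) := mul_le_mul_of_nonneg_left h1 hC0.le
    have h4 : C0 3 * (1 / (6 * C0 3)) = 1 / 6 := by field_simp
    linarith
  have hw4 : 4 * (2 * eN) ≤ c2' 3 L := by
    have h1 : eN ≤ c2' 3 L / 8 := by rw [heN]; exact (min_le_right _ _).trans (min_le_right _ _)
    linarith
  refine ⟨eN, heNpos, ?_⟩
  intro F hF n K hnK e he hle W hreg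
  subst hF
  have hreg' : RegPr F n K eN W := T3PrintedMinimiserExistence.regPr_mono F hle hreg
  have hd : (F.P K).d = 3 := T3Family.P_d F K
  have hw3' : C0 (F.P K).d * (2 * eN) ≤ 1 / 3 := by rw [hd]; exact hw3
  have hw4' : 4 * eN ≤ c2' (F.P K).d (F.P K).L := by rw [hd]; exact le_trans (by linarith) hw4
  exact ⟨fun w => coarseGrad_le_twelve_coarseMass_of_regPr F hnK.le heNpos hw1 W hreg' (hc₀ F.L).out.le w,
    fun μ => coarseMass_QprimeCombL2_le_normSq_of_regPr F hnK.le heNpos hw3' hw4' W hreg' μ⟩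

end Summit.QuantumFields.YangMills.Theorems.Prop7DivRecoveryCoarseRows

end
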